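import Summits.QuantumFields.BalabanUV.T4Continuum.Support.B13TermCoreMass
import Summits.QuantumFields.BalabanUV.T4Continuum.Support.B13StepEndLoc
import Summits.QuantumFields.BalabanUV.T4Continuum.Support.UrsellTermDecay

/-!
# B13AssemblyCoresEnd — row O1-d2-ii «act instance» of the NE5 crux O1, part 9: THE (2.14)-FACE WITH FACTOR CORES — the COMPOSITION booked by
# ruling R28 («/7 `termGaussianParamBi_term_of_factors` ∘ leaf-09's `B13StepEndLoc` = the END OF RECORD WITH (2.14) FACTOR CORES, filed by
# whoever lands second»): leaf-09-g2's R21 faces `B13StepEndLoc.ne5_of_assemblyOn_gaussianParamBi_mass_opRate` (assembled model over ANY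
# operator carrier) and `ne5_of_record_onSub_gaussianParamBi_mass` (the carriers OF RECORD on the sub-slot `M ≤ OpDatum E`, of record
# `↥measOp`, W1 PRODUCED from row NE2's entry currency) with their two (2.14) binders PRODUCED — `hBi` by part 7 (per-FACTOR operator letters)
# and `hmass` by part 8 (Gaussian mass of a term core ≤ `actMajorant` of factor masses) + a displayed PER-DOMAIN FACTOR-MASS BUDGET
# (cell `pub-balaban`, T⁴ fan-out, row O1-d2-ii; design v0.6 R18∕R20∕R21; journal R28 l.12164, leaf-09 l.12657)

Unit `b2b-balaban-t4-ne5-formalise-leaf-08` (NE5 formalisation swarm, leaf prover 08, gen 3).  Summits-side NEW WORK under the LEAN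
PLACEMENT RULE (cell modelling + bookkeeping; nothing of the manuscripts under audit is asserted; 0 cite tags).  HONEST FRAMING: rung
(B)+1 of the FINITE-VOLUME T⁴ continuum programme — NOT infinite volume, NOT a mass gap, NOT the Clay problem, NOT a proof of NE5
(`T4OutputRate.NE5` is NOT PRINTED and NOT PROVED; spine 0/9, unchanged).  HONEST DEPENDENCY (cell line, verbatim): continuum YM on T⁴ ⇐
BetaPertH ∧ nine spine estimates (0/9 proved); BetaPertH ⇐ (D1) ∧ (D4) ∧ CAP+tail; G-an2-4 gates asym, D1 and NE2/3/4.

WHAT THIS MODULE IS (MODEL LEVEL; `Op` polymorphic in §1, so the carrier of record `↥measOp` is included).  Two theorems, each ONE application of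
leaf-09's face with `hBi := B13TermCoreFamily.termGaussianParamBi_term_of_factors` and `hmass := (B13TermCoreMass.paramMass_termCore_le_actMajorant …).trans (hmaj …)`:
* §1 **`ne5_of_assemblyOn_cores`** — for `𝔄 : AssemblyOn C Op IOp (B13HistM P) ι Pol J` with `𝔄.act = actOfCores 𝔠` (any carriers, any `Op`).
* §2 **`ne5_of_record_onSub_cores`** — for the slots OF RECORD `S₀ : B13StepOfRecord.Slots R E IOp (B13HistM P)` on a sub-slot `M` holding the
  operator data of record, with cores `𝔠 Z ℓ : BiCore P (dom Z ℓ) ↥M (PΛ Z ℓ) (V Z ℓ)` (factor activities `actOfCores 𝔠` typed ON `↥M`,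
  R20); term indexing ∕ hard core OF RECORD (`labelsIndexing …` ∕ `touchInc …`); conclusion LITERALLY
  `T4OutputRate.NE5 (outA (onSub S₀ M hMA hMB (actOfCores 𝔠)) E₀ cB) (outB …) W κ θ′ C₅` with leaf-09's constant.
* §3 **`factorMass_budget_of_decay`** — the displayed budget `hmaj` in the O1-d2 (iii) engine's currency: factorwise decay against a stripped letter
  `A′` + the (2.27)-KIND geometric binder ⟹ `hmaj` with `a k i X := actMajorant 𝒯 inc (A′ k) k X i` (`UrsellTermDecay.actMajorant_le_exp_mul`).
DISPLAYED after these faces (exactly): leaf-09's non-(2.14) binders VERBATIM (transport reading; `SliceBudgetB κ cB`, `SliceBudget κ cA`; the two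
`DecayBound`s; W1 — `OperatorRate δ θ` in §1, the record's `RawBounded` ×2 + `WeightedEntrywiseRate c₁ θ^k` + floor `r₀` in §2; `InsertionRate`
(W4); `TermBudgetLoc a G`; radii; numerics incl. the SAME smallness `ω + G·cA∕(1 − ρ₀) < θ′`) PLUS, replacing `hBi`∕`hmass`: the FACTOR operator
letters (`0 < m⋆ ≤ mf`, `0 ≤ wB`, `0 ≤ N₀f`; per localizing tuple and factor `N` a.e.-s.m.∕holomorphic∕`≤ N₀f`, `q` jointly a.e.-s.m.∕holomorphic∕margin
`mf‖v‖² − bf ≤ Re q` on the operator ball), the history radius `‖(selfCtr …).2‖ + RHist k ≤ H k`, and the PER-DOMAIN FACTOR-MASS BUDGET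
`hmaj : B13TermRep.actMajorant 𝒯 inc (factorMass 𝔠 N₀f bf m⋆ (H k)) k X i ≤ a k i X·e^{−κd(X)}` ((2.38)–(2.41) KIND: one-factor majorant masses ×
the tuple combinatorics, summable per domain by `hbud`).

STATUS (census, Edison rule).  Composition BY NAME; no estimate of [II] is proved or asserted; nothing is instantiated on Bałaban's concrete
objects — the cores `𝔠` (contours: part 5; χ's: part 2; Gaussian letters `N`, `q`: rows NE2∕NE3's objects), their letters, the factor-mass
budget, W1's currency, the slice budgets and the levels are the instancer's ∕ the other rows'.  NE5 NOT PROVED; 0/12 leaves on Bałaban's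
concrete objects; spine 0/9; rung (B)+1 finite T⁴; NOT infinite volume ∕ mass gap ∕ Clay.  0 sorry; axioms ⊆ {propext, Classical.choice, Quot.sound}.
-/

noncomputable section

open scoped BigOperators
open Set Metric MeasureTheory

namespace Summit.QuantumFields.BalabanUV.T4Continuum.B13AssemblyCoresEnd

open Literature.MathematicalPhysics.QuantumFieldTheory.Balaban1983to89
open Literature.MathematicalPhysics.QuantumFieldTheory.Balaban1983to89.T4OutputRate (Carriers Functional DecayBound NE5)
open Literature.MathematicalPhysics.QuantumFieldTheory.Balaban1983to89.T4InputCauchyRateData (StepModel)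
open Summit.QuantumFields.BalabanUV.T4Continuum.B13Carriers (TwoRuns)
open Summit.QuantumFields.BalabanUV.T4Continuum.B13OpDatum (OpDatum)
open Summit.QuantumFields.BalabanUV.T4Continuum.B13OpDatumJunctions (opOf RawBounded WeightedEntrywiseRate)
open Summit.QuantumFields.BalabanUV.T4Continuum.B13StepTermLabels (TermIdx InnerLabel)
open Summit.QuantumFields.BalabanUV.T4Continuum.B13StepTermFamily (TermIndexing term)
open Summit.QuantumFields.BalabanUV.T4Continuum.B13InnerData (Bnd)
open Summit.QuantumFields.BalabanUV.T4Continuum.B13HistMeasurable (MeasPotFrame B13HistM)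
open Summit.QuantumFields.BalabanUV.T4Continuum.B13TermRep (actMajorant)
open Summit.QuantumFields.BalabanUV.T4Continuum.B13TermParamGaussianBi (BiCore)
open Summit.QuantumFields.BalabanUV.T4Continuum.B13TermCoreFamily (actOfCores factorCores termGaussianParamBi_term_of_factors)
open Summit.QuantumFields.BalabanUV.T4Continuum.B13TermCoreMass (factorMass factorMass_nonneg paramMass_termCore_le_actMajorant)
open Summit.QuantumFields.BalabanUV.T4Continuum.UrsellTermDecay (actMajorant_le_exp_mul)
open Summit.QuantumFields.BalabanUV.T4Continuum.B13Base (selfCtr)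
open Summit.QuantumFields.BalabanUV.T4Continuum.B13RepresentsOn (AssemblyOn)
open Summit.QuantumFields.BalabanUV.T4Continuum.B13StepOfRecord (Slots assembly step)
open Summit.QuantumFields.BalabanUV.T4Continuum.B13StepOfRecordSub (assemblyOn onSub outA outB transportReads_onSub_iff
  sliceBudgetB_onSub_iff sliceBudget_onSub_iff insertionRate_onSub_iff operatorRate_onSub_of_weightedEntrywise)
open Summit.QuantumFields.BalabanUV.T4Continuum.OutputRateTermwiseLoc (TermBudgetLoc)
open Summit.QuantumFields.BalabanUV.T4Continuum.B13StepEndLoc (ne5_of_assemblyOn_gaussianParamBi_mass_opRate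
  ne5_of_record_onSub_gaussianParamBi_mass)

/-- [folklore] Points of a closed ball are bounded in norm by the centre's norm plus the radius. -/
theorem norm_le_of_mem_closedBall' {E : Type*} [SeminormedAddCommGroup E] {c h : E} {r : ℝ} (hh : h ∈ closedBall c r) :
    ‖h‖ ≤ ‖c‖ + r := by
  have h1 : ‖h - c‖ ≤ r := by rwa [mem_closedBall, dist_eq_norm] at hh
  calc ‖h‖ = ‖c + (h - c)‖ := by rw [add_sub_cancel]
    _ ≤ ‖c‖ + ‖h - c‖ := norm_add_le _ _
    _ ≤ ‖c‖ + r := by linarith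

/-! ## §1 The (2.14)-face with factor cores on an assembled step over any operator carrier -/

section OverOp

variable {C : Carriers} {P : MeasPotFrame C} {Op IOp : Type*} [NormedAddCommGroup Op] [NormedSpace ℂ Op] {ι Pol J : Type*}
  {𝒴 : Pol → J → Type*} {dom : ∀ Z j, 𝒴 Z j → C.Dom} {PΛ : Pol → J → Type*} {V : Pol → J → Type*}
  [∀ Z j, MeasurableSpace (PΛ Z j)] [∀ Z j, NormedAddCommGroup (V Z j)] [∀ Z j, InnerProductSpace ℝ (V Z j)]
  [∀ Z j, MeasurableSpace (V Z j)] [∀ Z j, BorelSpace (V Z j)] [∀ Z j, FiniteDimensional ℝ (V Z j)]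

/-- **THE (2.14)-FACE WITH FACTOR CORES, ASSEMBLED STEP OVER `Op`** — leaf-09's `ne5_of_assemblyOn_gaussianParamBi_mass_opRate` for
`𝔄 : AssemblyOn C Op IOp (B13HistM P) ι Pol J` whose activity slot IS `actOfCores 𝔠`, with `hBi` PRODUCED by part 7 from the FACTOR operator
letters and `hmass` PRODUCED by part 8 from the per-domain factor-mass budget `hmaj`; every other binder is leaf-09's, VERBATIM and in the same
order; SAME constant.  NOT a proof of NE5 for Bałaban's step (see the module docstring). [folklore] -/
theorem ne5_of_assemblyOn_cores (𝔄 : AssemblyOn C Op IOp (B13HistM P) ι Pol J)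
    (𝔠 : ∀ Z j, BiCore P (dom Z j) Op (PΛ Z j) (V Z j)) (hact : 𝔄.act = actOfCores 𝔠)
    {W : Set (ℕ → ℝ)} {ROp RHist R' H : ℕ → ℝ} {a : ℕ → ι → C.Dom → ℝ} {N₀f mf bf : Pol → J → ℝ}
    {mstar κ G EA₀ E₀ E₁ cA cB δ δ' θ θ' ρ₀ B : ℝ} {k₀ : ℕ}
    (hT : 𝔄.TransportReads W)
    (hbB : 𝔄.SliceBudgetB W κ cB) (hbA : 𝔄.D.SliceBudget (𝔄.stepOn (𝔄.bHist E₀ cB)) W κ cA)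
    (hdA : DecayBound (𝔄.outA (𝔄.bHist E₀ cB)) W EA₀ κ) (hdB : DecayBound (𝔄.outB (𝔄.bHist E₀ cB)) W E₀ κ)
    (hop : (𝔄.stepOn (𝔄.bHist E₀ cB)).OperatorRate W δ θ) (hins : (𝔄.stepOn (𝔄.bHist E₀ cB)).InsertionRate W κ E₀ δ' θ)
    (hbud : TermBudgetLoc a G) (hOp : ∀ k, 𝔄.rOp k ≤ ROp k) (hroom : ∀ k, ROp k < R' k)
    (hHist : ∀ k, 𝔄.bHist E₀ cB k + 𝔄.rHist k ≤ RHist k)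
    -- the FACTOR operator letters of the cores (replace `hBi`)
    (hm : 0 < mstar) (hmf : ∀ Z j, mstar ≤ mf Z j) (hwB : ∀ Z j, 0 ≤ (𝔠 Z j).wB) (hN₀ : ∀ Z j, 0 ≤ N₀f Z j)
    (hNf : ∀ k, ∀ g ∈ W, ∀ (U : C.BgB) (X : C.Dom), C.scale X = k → ∀ i, 𝔄.𝒯.Rel k i X → ∀ m : Fin (𝔄.𝒯.len i + 1),
      (∀ o ∈ ball (selfCtr 𝔄.raw 𝔄.histRef k g U).1 (R' k),
        AEStronglyMeasurable ((factorCores 𝔄.𝒯 𝔠 i m).N o) (factorCores 𝔄.𝒯 𝔠 i m).lam) ∧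
      (∀ p, DifferentiableOn ℂ (fun o => (factorCores 𝔄.𝒯 𝔠 i m).N o p) (ball (selfCtr 𝔄.raw 𝔄.histRef k g U).1 (R' k))) ∧
      (∀ o ∈ ball (selfCtr 𝔄.raw 𝔄.histRef k g U).1 (R' k), ∀ p,
        ‖(factorCores 𝔄.𝒯 𝔠 i m).N o p‖ ≤ N₀f (𝔄.𝒯.poly i m) (𝔄.𝒯.lab i m)))
    (hqf : ∀ k, ∀ g ∈ W, ∀ (U : C.BgB) (X : C.Dom), C.scale X = k → ∀ i, 𝔄.𝒯.Rel k i X → ∀ m : Fin (𝔄.𝒯.len i + 1),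
      (∀ o ∈ ball (selfCtr 𝔄.raw 𝔄.histRef k g U).1 (R' k),
        AEStronglyMeasurable (Function.uncurry ((factorCores 𝔄.𝒯 𝔠 i m).q o)) ((factorCores 𝔄.𝒯 𝔠 i m).lam.prod volume)) ∧
      (∀ p v, DifferentiableOn ℂ (fun o => (factorCores 𝔄.𝒯 𝔠 i m).q o p v) (ball (selfCtr 𝔄.raw 𝔄.histRef k g U).1 (R' k))) ∧
      (∀ o ∈ ball (selfCtr 𝔄.raw 𝔄.histRef k g U).1 (R' k), ∀ p v,
        mf (𝔄.𝒯.poly i m) (𝔄.𝒯.lab i m) * ‖v‖ ^ 2 - bf (𝔄.𝒯.poly i m) (𝔄.𝒯.lab i m) ≤ ((factorCores 𝔄.𝒯 𝔠 i m).q o p v).re))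
    -- the history radius and the per-domain FACTOR-MASS budget (replace `hmass`)
    (hH : ∀ k, ∀ g ∈ W, ∀ U : C.BgB, ‖(selfCtr 𝔄.raw 𝔄.histRef k g U).2‖ + RHist k ≤ H k)
    (hmaj : ∀ k, ∀ g ∈ W, ∀ (U : C.BgB) (X : C.Dom), C.scale X = k → ∀ i,
      actMajorant 𝔄.𝒯 𝔄.inc (factorMass 𝔠 N₀f bf mstar (H k)) k X i ≤ a k i X * Real.exp (-(κ * C.d X)))
    (hE₀ : 0 ≤ E₀) (hE₁ : 0 < E₁) (hG : 0 ≤ G) (hcA : 0 ≤ cA) (hcB : 0 ≤ cB) (hδ : 0 ≤ δ) (hδ' : 0 ≤ δ')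
    (hθ : 0 ≤ θ) (hθθ' : θ ≤ θ') (hθ'1 : θ' ≤ 1) (hω : 0 < 𝔄.D.ω) (hω1 : 𝔄.D.ω < 1) (hρ₀ : ρ₀ < 1)
    (hnear : (δ + δ') * θ ^ k₀ + cA * (EA₀ + E₀) / (1 - 𝔄.D.ω) ≤ ρ₀) (hB : 0 ≤ B)
    (hfirst : ∀ k < k₀, EA₀ + E₀ ≤ B * θ ^ k) (hsmall : 𝔄.D.ω + G / (1 - ρ₀) * cA < θ') :
    NE5 (𝔄.outA (𝔄.bHist E₀ cB)) (𝔄.outB (𝔄.bHist E₀ cB)) W κ θ'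
      ((G / (1 - ρ₀) * δ + G / (1 - ρ₀) * δ' + B) * (θ' - 𝔄.D.ω) / (θ' - (𝔄.D.ω + G / (1 - ρ₀) * cA))) := by
  have hBi := termGaussianParamBi_term_of_factors (𝒯 := 𝔄.𝒯) (inc := 𝔄.inc) (𝔠 := 𝔠) (W := W)
    (ctr := selfCtr 𝔄.raw 𝔄.histRef) (RHist := RHist) (R' := R') (fun Z j => hm.trans_le (hmf Z j)) hNf hqf
  rw [← hact] at hBi
  exact ne5_of_assemblyOn_gaussianParamBi_mass_opRate 𝔄
    (fun _ i => PiLp 2 fun m : Fin (𝔄.𝒯.len i + 1) => V (𝔄.𝒯.poly i m) (𝔄.𝒯.lab i m))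
    hT hbB hbA hdA hdB hop hins hbud hOp hroom hHist hBi
    (fun k g hg U _h hh X hX i => (paramMass_termCore_le_actMajorant (𝒯 := 𝔄.𝒯) (inc := 𝔄.inc) (𝔠 := 𝔠) hm hmf hwB hN₀ k i X
      ((norm_le_of_mem_closedBall' hh).trans (hH k g hg U))).trans (hmaj k g hg U X hX i))
    hE₀ hE₁ hG hcA hcB hδ hδ' hθ hθθ' hθ'1 hω hω1 hρ₀ hnear hB hfirst hsmall

end OverOp

/-! ## §2 The (2.14)-face with factor cores on the carriers OF RECORD, cores typed on the sub-slot `M` (of record `↥measOp`, R20) -/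

section OnSub

variable {G : Type} [GaugeGroup G] {R : TwoRuns G} {E IOp : Type*} {P : MeasPotFrame R.carriers}
  (S₀ : Slots R E IOp (B13HistM P)) (M : Submodule ℂ (OpDatum E))
  (hMA : ∀ g V k, opOf S₀.F S₀.rawA g V k ∈ M) (hMB : ∀ g U k, opOf S₀.F S₀.rawB g U k ∈ M)
  {𝒴 : R.carriers.Dom → InnerLabel R.carriers.Dom (Bnd R) → Type*} {dom : ∀ Z ℓ, 𝒴 Z ℓ → R.carriers.Dom}
  {PΛ : R.carriers.Dom → InnerLabel R.carriers.Dom (Bnd R) → Type*} {V : R.carriers.Dom → InnerLabel R.carriers.Dom (Bnd R) → Type*}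
  [∀ Z ℓ, MeasurableSpace (PΛ Z ℓ)] [∀ Z ℓ, NormedAddCommGroup (V Z ℓ)] [∀ Z ℓ, InnerProductSpace ℝ (V Z ℓ)]
  [∀ Z ℓ, MeasurableSpace (V Z ℓ)] [∀ Z ℓ, BorelSpace (V Z ℓ)] [∀ Z ℓ, FiniteDimensional ℝ (V Z ℓ)]
  (𝔠 : ∀ Z ℓ, BiCore P (dom Z ℓ) M (PΛ Z ℓ) (V Z ℓ)) (E₀ cB : ℝ)

/-- **THE (2.14)-FACE WITH FACTOR CORES ON THE SUB-SLOT OF RECORD** — the binder list of leaf-09's `ne5_of_record_onSub_gaussianParamBi_mass` at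
`act := actOfCores 𝔠`, applied BY NAME (ruling R32: no transport re-derived here); the factor letters are stated on the RECORD's indexing `(assembly S₀).𝒯` ∕
hard core `(assembly S₀).inc` and about the record's data `opOf F rawB g U k` ∕ `(assembly S₀).histRef` — `rfl`-equal to the face's
`(assemblyOn (onSub …)).𝒯`-spelled binders, and small enough to elaborate at default heartbeats (the fully spelled statement is not) (factor activities = the terms of (2.14)-cores typed ON `↥M`), `hBi` PRODUCED by part 7 on the term indexing ∕ hard core OF
RECORD (`(assemblyOn …).𝒯 = labelsIndexing (domainGeometry R) (b13InnerData R)`, `(assemblyOn …).inc = touchInc …`, `rfl`), `hmass` PRODUCED by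
part 8 + the displayed per-domain factor-mass budget; W1 PRODUCED by leaf-09∕leaf-03 from the record's bounded raw suppliers and row NE2's
weighted entrywise rate; every other binder VERBATIM.  Conclusion LITERALLY
`T4OutputRate.NE5 (outA (onSub S₀ M hMA hMB (actOfCores 𝔠)) E₀ cB) (outB (onSub S₀ M hMA hMB (actOfCores 𝔠)) E₀ cB) W κ θ′ C₅`.  The slot OF RECORD is
`M := B13OpMeasurable.measOp …` (spell `onSub S₀ (measOp …) hA hB (actOfCores 𝔠)`; `hA`∕`hB` from `B13StepOfRecordSub.opA_mem_measOp`∕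
`opB_mem_measOp`).  NOT a proof of NE5 for Bałaban's step. [folklore] -/
theorem ne5_of_record_onSub_cores {W : Set (ℕ → ℝ)} {ROp RHist R' H : ℕ → ℝ}
    {a : ℕ → TermIdx R.carriers.Dom (Bnd R) → R.carriers.Dom → ℝ}
    {N₀f mf bf : R.carriers.Dom → InnerLabel R.carriers.Dom (Bnd R) → ℝ}
    {mstar κ G EA₀ E₁ cA c₁ r₀ δ' θ θ' ρ₀ B : ℝ} {k₀ : ℕ}
    (hT : (assembly S₀).TransportReads W)
    (hbB : (assembly S₀).SliceBudgetB W κ cB) (hbA : S₀.D.SliceBudget (step S₀ E₀ cB) W κ cA)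
    (hdA : DecayBound (outA (onSub S₀ M hMA hMB (actOfCores 𝔠)) E₀ cB) W EA₀ κ)
    (hdB : DecayBound (outB (onSub S₀ M hMA hMB (actOfCores 𝔠)) E₀ cB) W E₀ κ)
    (hRA : RawBounded S₀.F (assembly S₀).rawAt W) (hRB : RawBounded S₀.F S₀.rawB W)
    (hwer : WeightedEntrywiseRate S₀.F (assembly S₀).rawAt S₀.rawB W c₁ fun k => θ ^ k) (hfl : ∀ k, r₀ ≤ S₀.rOp k)
    (hins : (step S₀ E₀ cB).InsertionRate W κ E₀ δ' θ)
    (hbud : TermBudgetLoc a G) (hOp : ∀ k, S₀.rOp k ≤ ROp k) (hroom : ∀ k, ROp k < R' k)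
    (hHist : ∀ k, (assembly S₀).bHist E₀ cB k + S₀.rHist k ≤ RHist k)
    -- the FACTOR operator letters of the cores (replace `hBi`): on the record's term indexing `(assembly S₀).𝒯 = labelsIndexing …`, over the
    -- operator ball IN `↥M` about run B's datum of record `opOf F rawB g U k` (all `rfl`-equal to §1's binders at `𝔄 := assemblyOn (onSub …)`)
    (hm : 0 < mstar) (hmf : ∀ Z ℓ, mstar ≤ mf Z ℓ) (hwB : ∀ Z ℓ, 0 ≤ (𝔠 Z ℓ).wB) (hN₀ : ∀ Z ℓ, 0 ≤ N₀f Z ℓ)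
    (hNf : ∀ k, ∀ g ∈ W, ∀ (U : R.carriers.BgB) (X : R.carriers.Dom), R.carriers.scale X = k →
      ∀ i, (assembly S₀).𝒯.Rel k i X → ∀ m : Fin ((assembly S₀).𝒯.len i + 1),
      (∀ o ∈ ball (⟨opOf S₀.F S₀.rawB g U k, hMB g U k⟩ : M) (R' k),
        AEStronglyMeasurable ((factorCores (assembly S₀).𝒯 𝔠 i m).N o) (factorCores (assembly S₀).𝒯 𝔠 i m).lam) ∧
      (∀ p, DifferentiableOn ℂ (fun o => (factorCores (assembly S₀).𝒯 𝔠 i m).N o p)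
        (ball (⟨opOf S₀.F S₀.rawB g U k, hMB g U k⟩ : M) (R' k))) ∧
      (∀ o ∈ ball (⟨opOf S₀.F S₀.rawB g U k, hMB g U k⟩ : M) (R' k), ∀ p,
        ‖(factorCores (assembly S₀).𝒯 𝔠 i m).N o p‖ ≤ N₀f ((assembly S₀).𝒯.poly i m) ((assembly S₀).𝒯.lab i m)))
    (hqf : ∀ k, ∀ g ∈ W, ∀ (U : R.carriers.BgB) (X : R.carriers.Dom), R.carriers.scale X = k →
      ∀ i, (assembly S₀).𝒯.Rel k i X → ∀ m : Fin ((assembly S₀).𝒯.len i + 1),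
      (∀ o ∈ ball (⟨opOf S₀.F S₀.rawB g U k, hMB g U k⟩ : M) (R' k),
        AEStronglyMeasurable (Function.uncurry ((factorCores (assembly S₀).𝒯 𝔠 i m).q o))
          ((factorCores (assembly S₀).𝒯 𝔠 i m).lam.prod volume)) ∧
      (∀ p v, DifferentiableOn ℂ (fun o => (factorCores (assembly S₀).𝒯 𝔠 i m).q o p v)
        (ball (⟨opOf S₀.F S₀.rawB g U k, hMB g U k⟩ : M) (R' k))) ∧
      (∀ o ∈ ball (⟨opOf S₀.F S₀.rawB g U k, hMB g U k⟩ : M) (R' k), ∀ p v,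
        mf ((assembly S₀).𝒯.poly i m) ((assembly S₀).𝒯.lab i m) * ‖v‖ ^ 2 - bf ((assembly S₀).𝒯.poly i m) ((assembly S₀).𝒯.lab i m) ≤
          ((factorCores (assembly S₀).𝒯 𝔠 i m).q o p v).re))
    -- the history radius about the record's history reference, and the per-domain FACTOR-MASS budget (replace `hmass`)
    (hH : ∀ k, ∀ g ∈ W, ∀ U : R.carriers.BgB, ‖(assembly S₀).histRef g U k‖ + RHist k ≤ H k)
    (hmaj : ∀ k, ∀ g ∈ W, ∀ (U : R.carriers.BgB) (X : R.carriers.Dom), R.carriers.scale X = k → ∀ i,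
      actMajorant (assembly S₀).𝒯 (assembly S₀).inc (factorMass 𝔠 N₀f bf mstar (H k)) k X i ≤
        a k i X * Real.exp (-(κ * R.carriers.d X)))
    (hE₀ : 0 ≤ E₀) (hE₁ : 0 < E₁) (hG : 0 ≤ G) (hcA : 0 ≤ cA) (hcB : 0 ≤ cB) (hc₁ : 0 ≤ c₁) (hr₀ : 0 < r₀) (hδ' : 0 ≤ δ')
    (hθ : 0 ≤ θ) (hθθ' : θ ≤ θ') (hθ'1 : θ' ≤ 1) (hω : 0 < S₀.D.ω) (hω1 : S₀.D.ω < 1) (hρ₀ : ρ₀ < 1)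
    (hnear : (c₁ / r₀ + δ') * θ ^ k₀ + cA * (EA₀ + E₀) / (1 - S₀.D.ω) ≤ ρ₀) (hB : 0 ≤ B)
    (hfirst : ∀ k < k₀, EA₀ + E₀ ≤ B * θ ^ k) (hsmall : S₀.D.ω + G / (1 - ρ₀) * cA < θ') :
    NE5 (outA (onSub S₀ M hMA hMB (actOfCores 𝔠)) E₀ cB) (outB (onSub S₀ M hMA hMB (actOfCores 𝔠)) E₀ cB) W κ θ'
      ((G / (1 - ρ₀) * (c₁ / r₀) + G / (1 - ρ₀) * δ' + B) * (θ' - S₀.D.ω) / (θ' - (S₀.D.ω + G / (1 - ρ₀) * cA))) :=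
  -- leaf-09's sub-slot face BY NAME at `act := actOfCores 𝔠`, with `hBi` from part 7 and `hmass` from part 8 + `hmaj`
  -- (the factor letters above are `rfl`-equal to their `(assemblyOn (onSub …)).𝒯`-spelled forms).
  ne5_of_record_onSub_gaussianParamBi_mass S₀ M hMA hMB (actOfCores 𝔠) E₀ cB
    (fun _ i => PiLp 2 fun m : Fin ((assembly S₀).𝒯.len i + 1) => V ((assembly S₀).𝒯.poly i m) ((assembly S₀).𝒯.lab i m))
    hT hbB hbA hdA hdB hRA hRB hwer hfl hins hbud hOp hroom hHist
    (termGaussianParamBi_term_of_factors (𝒯 := (assembly S₀).𝒯) (inc := (assembly S₀).inc) (𝔠 := 𝔠) (W := W)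
      (ctr := fun k g U => ((⟨opOf S₀.F S₀.rawB g U k, hMB g U k⟩ : M), (assembly S₀).histRef g U k))
      (RHist := RHist) (R' := R') (fun Z ℓ => hm.trans_le (hmf Z ℓ)) hNf hqf)
    (fun k g hg U _h hh X hX i =>
      (paramMass_termCore_le_actMajorant (𝒯 := (assembly S₀).𝒯) (inc := (assembly S₀).inc) (𝔠 := 𝔠) hm hmf hwB hN₀ k i X
        ((norm_le_of_mem_closedBall' hh).trans (hH k g hg U))).trans (hmaj k g hg U X hX i))
    hE₀ hE₁ hG hcA hcB hc₁ hr₀ hδ' hθ hθθ' hθ'1 hω hω1 hρ₀ hnear hB hfirst hsmall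

end OnSub

/-! ## §3 The displayed factor-mass budget `hmaj` in the O1-d2 (iii) engine's currency -/

section Budget

variable {C : Carriers} {P : MeasPotFrame C} {Op : Type*} {ι Pol J : Type*} (𝒯 : TermIndexing C ι Pol J)
  (inc : Pol → Pol → Prop) [DecidableRel inc]
  {𝒴 : Pol → J → Type*} {dom : ∀ Z j, 𝒴 Z j → C.Dom} {PΛ : Pol → J → Type*} {V : Pol → J → Type*}
  [∀ Z j, MeasurableSpace (PΛ Z j)] [∀ Z j, NormedAddCommGroup (V Z j)] [∀ Z j, InnerProductSpace ℝ (V Z j)]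
  [∀ Z j, MeasurableSpace (V Z j)] (𝔠 : ∀ Z j, BiCore P (dom Z j) Op (PΛ Z j) (V Z j))

/-- **`hmaj` FROM FACTORWISE DECAY** — the (2.40)-shape extraction of the O1-d2 (iii) Ursell engine (`UrsellTermDecay.actMajorant_le_exp_mul`) at
`A := factorMass 𝔠 N₀f bf m⋆ (H k)`: if every factor mass decays against a STRIPPED letter, `factorMass … (H k) Z j ≤ A′ k Z j·e^{−κ s(Z)}`, and
the tuples localizing at a step-`k` domain `X` satisfy the geometric binder `C.d X ≤ Σ_m s(poly i m)` ((2.27) KIND), then the per-domain factor-mass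
budget `hmaj` of §§1–2 holds with `a k i X := actMajorant 𝒯 inc (A′ k) k X i`; its `TermBudgetLoc` is then the engine's per-domain budget for the
stripped majorant (`UrsellTermBudget.tsum_actMajorant_le` on the record's indexing).  Both inequalities stay DISPLAYED. [folklore] -/
theorem factorMass_budget_of_decay {N₀f bf : Pol → J → ℝ} {mstar κ : ℝ} {H : ℕ → ℝ} {A' : ℕ → Pol → J → ℝ} {s : Pol → ℝ}
    (hwB : ∀ Z j, 0 ≤ (𝔠 Z j).wB) (hN₀ : ∀ Z j, 0 ≤ N₀f Z j) (hm : 0 < mstar) (hA' : ∀ k Z j, 0 ≤ A' k Z j) (hκ : 0 ≤ κ)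
    (hdec : ∀ k Z j, factorMass 𝔠 N₀f bf mstar (H k) Z j ≤ A' k Z j * Real.exp (-(κ * s Z)))
    (hgeo : ∀ k (X : C.Dom), C.scale X = k → ∀ i, 𝒯.Rel k i X → C.d X ≤ ∑ m, s (𝒯.poly i m))
    (k : ℕ) (X : C.Dom) (hX : C.scale X = k) (i : ι) :
    actMajorant 𝒯 inc (factorMass 𝔠 N₀f bf mstar (H k)) k X i ≤ actMajorant 𝒯 inc (A' k) k X i * Real.exp (-(κ * C.d X)) := by
  rw [mul_comm]
  exact actMajorant_le_exp_mul (fun Z j => factorMass_nonneg hwB hN₀ hm Z j) (hA' k) hκ (hdec k) (hgeo k X hX) i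

end Budget

end Summit.QuantumFields.BalabanUV.T4Continuum.B13AssemblyCoresEnd

end
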